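import Summits.Ventures.PercRepro.Night2DiagonalReductionB
import Summits.Ventures.PercRepro.Night2LocalDQFive

/-!
# PercRepro — the `(7, 5)` shadow row reduced to the flats with `|E ∖ G| ≤ q′ − 1` (night-2, gen 11)

`shadowHall_diag_of_local_fat_simple_three` at `q = 5` needs the fat local forms for `q′ ∈ {4, 5}`; the regime
`|E ∖ G| = q′` is a theorem there (`localShadowHall_dq_four_of_simple`, `localShadowHall_dq_five_of_simple`),
so the residual is `|E ∖ G| ∈ {2, 3}` at `q′ = 4` and `|E ∖ G| ∈ {2, 3, 4}` at `q′ = 5`: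

* **`shadowHall_seven_five_of_local`**: `ShadowHall M 7 5 (phiK 7 5)` for every finite matroid, modulo the
  local form at the rank-`5` flats with `|E ∖ G| ∈ {2, 3}` of loopless simple rank-`6` matroids and at the
  rank-`6` flats with `|E ∖ G| ∈ {2, 3, 4}` of loopless simple rank-`7` matroids.
-/

open scoped Matroid

namespace PercRepro.Shadow

open Finset PerFlat ThmH

variable {α : Type} [DecidableEq α]

/-- `Φ(7, 5) = 7/6 = (5 + 2)/(5 + 1)`. -/
theorem phiK_seven_five_ratio : phiK 7 5 = (((5 : ℕ) : ℚ) + 2) / (((5 : ℕ) : ℚ) + 1) := by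
  unfold phiK
  rw [show Finset.Ioo 5 7 = {6} by decide, Finset.sum_singleton,
    show Nat.choose (7 + 5) 6 = 924 by decide, show Nat.choose (7 + 5) 7 = 792 by decide]
  norm_num

/-- **The `(7, 5)` shadow row for every finite matroid, modulo the fat local forms with `|E ∖ G| ≤ q′ − 1` at
`q′ ∈ {4, 5}`** (the regime `|E ∖ G| = q′` being a theorem for simple matroids). -/
theorem shadowHall_seven_five_of_local
    (hloc4 : ∀ (N : Matroid α) [N.Finite], (∀ e ∈ gr N, ∀ f ∈ gr N, e ≠ f → rkN N {e, f} = 2) →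
      (∀ e ∈ gr N, N.Indep {e}) → N.eRank = ((4 + 2 : ℕ) : ℕ∞) →
      ∀ G ∈ flatsQ N (4 + 1), 2 ≤ (gr N \ G).card → (gr N \ G).card ≤ 3 → LocalShadowHall N 4 G)
    (hloc5 : ∀ (N : Matroid α) [N.Finite], (∀ e ∈ gr N, ∀ f ∈ gr N, e ≠ f → rkN N {e, f} = 2) →
      (∀ e ∈ gr N, N.Indep {e}) → N.eRank = ((5 + 2 : ℕ) : ℕ∞) →
      ∀ G ∈ flatsQ N (5 + 1), 2 ≤ (gr N \ G).card → (gr N \ G).card ≤ 4 → LocalShadowHall N 5 G)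
    (M : Matroid α) [M.Finite] : ShadowHall M 7 5 (phiK 7 5) := by
  rw [phiK_seven_five_ratio]
  refine shadowHall_diag_of_local_fat_simple_three 5 (by norm_num) ?_ M
  intro q' h4 h5 N _ hs hl hN G hG h2 hd
  have hq' : q' = 4 ∨ q' = 5 := by omega
  rcases hq' with rfl | rfl
  · rcases Nat.lt_or_ge (gr N \ G).card 4 with hlt | hge
    · exact hloc4 N hs hl hN G hG h2 (by omega)
    · exact localShadowHall_dq_four_of_simple hs hl hG (by omega)
  · rcases Nat.lt_or_ge (gr N \ G).card 5 with hlt | hge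
    · exact hloc5 N hs hl hN G hG h2 (by omega)
    · exact localShadowHall_dq_five_of_simple hs hl hG (by omega)

end PercRepro.Shadow
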